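import Summits.BirchSwinnertonDyer.BirchSwinnertonDyer.Theorems.PrintCf2SplitBadTwoNormAtVbarTwistedLocal
import Summits.BirchSwinnertonDyer.BirchSwinnertonDyer.Theorems.PrintCf2SplitBadTwoNormAtVbarUnramified
import HarnessLib

/-!
# Crux `PrintCf2.SplitBadTwoRankOneOfFacts` (stmt-BirchSwinnertonDyer-20368), skeleton v13.5, (REG₂) `stub_xRegular_two` FACT-FREE road, R2 brick
# **B5-T-loc (FILE 6): `|ẑ|_v̄ = |z|_{w₀}` AND THE ASSEMBLED LOCAL HALF OF THE TWISTED `v̄` READING** — the dual-of-unramified condition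
# at `v̄` of a class read by Kummer theory on `Gal(K̄/Z) ⊇ D_v̄` forces `n ∣ ord_{w₀}(z)` at the place `w₀` of `Z` below `𝔓₀`

Cell `bsd-print-cf2`, EXTRA WIDTH seat `bsd-line-cf2-p1-w3` g14 (prover-bsd-line-cf2-p1-w3-g14-0); `--supports stmt-BirchSwinnertonDyer-20368`
(helper, Theses-free). HONEST FRAMING: nothing here closes the crux or a registered stub; BSD is not proved by any of this; no summit
statement is proved by this seat. No definition, no named fact, no `sorry`. UNCONDITIONAL.

WHY. FILE 5 (p708759, `dvd_log_valued_of_mem_dualLocalCondition_unramified_of_locallyTrivial`) reads 6b's clause (iii) at `v̄` for coefficients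
trivial on `D_v̄` as `n ∣ log |ẑ|_v̄` for the element `ẑ ∈ K_v̄` with `ẑ = ι(ζⁿ)`; the consumer (-w4 g14's ρ_ε-probe for the TWISTED dual levels,
B5-T, STATUS 07:55:20Z / 08:1xZ) holds `z = ζⁿ = N_{F′/K_ε}(b′)` in the number field `Z = K_ε ⊆ K̄` and needs the `w₀`-ADIC valuation of `z`.
WHAT.
* §1 `le_exp_neg_of_mem_pow`, **`eq_intValuation_of_sandwich`** — on a Dedekind domain a multiplicative ultrametric `V ≤ 1` with `V ≤ exp(-1)` on
  `𝔭` and `V(π) = exp(-1)` at some `π ∈ 𝔭` equals the `𝔭`-adic valuation (`a ∈ 𝔭^k ⟹ V a ≤ exp(-k)`; `𝔭^{k+1} + (a) = 𝔭^k ∋ π^k`,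
  `Ideal.irreducible_pow_sup_of_ge`, gives `V a ≥ exp(-k)`).
* §2 **`valued_eq_valuation_of_forall_absGaloisRestrict_mem_galFixing`** — `Z/K` finite Galois in `K̄` with `res(Γ_{K_v̄}) ≤ Gal(K̄/Z)` and all
  inertia above `v̄` in `Gal(K̄/Z)`, `w₀ = ι⁻¹(𝔓₀) ∩ Z`: for `z ∈ Z` and `ẑ ∈ K_v̄` with `ẑ = ι(z)` in `\bar K_v̄`, `Valued.v ẑ = w₀.valuation Z z`.
  (`x ↦ |ι x|_v̄` on `𝓞 Z` is `≤ 1` — `spectralNorm_absClosureEmbedding_le_one` —, `< 1` exactly on `w₀` — `mem_adicCompletionPrime_iff` —, and a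
  `v̄`-uniformizer of `K` is a `w₀`-uniformizer as `e(w₀∣v̄) = 1` — `isUnramifiedIn_of_forall_inertia_le` (FILE 3), `intValuation_liesOver`; §1; fractions.)
* §3 **`dvd_log_valuation_of_mem_dualLocalCondition_unramified_of_decompFixed`** — THE SOCKET: `ρ` on `ℤ/n` trivial on `res(Γ_{K_v̄})`, `φ` a
  `1`-cocycle in `(ℤ/n)^D` with `loc_v̄[φ] ∈ (H¹_ur)^⊥`, `Z, w₀` as in §2, `z ∈ Z`, `ζⁿ = z`, `muVal(φ(g)(1)) = g ζ / ζ` on `Gal(K̄/Z)` ⟹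
  `(n : ℤ) ∣ log (w₀.valuation Z z)`.
* §4 **`mul_ramificationIdx_dvd_log_valuation_of_coe_mem`** — the same read at any finite `Z′ ⊇ Z` (the assembler's `F′ ⊇ K_ε`, -w4 g14 REQUEST
  08:20:26Z): for `z′ ∈ Z′` with `↑z′ ∈ Z` and the place `w′` of `Z′` below `𝔓₀`, `n · e(w′∣v̄) ∣ log (w′.valuation Z′ z′)`; TOWER-FREE statement
  (the `Z → Z′` algebra from `IntermediateField.inclusion` is local to the proof; `e(w′∣v̄) = e(w′∣w)` as `e(w∣v̄) = 1`, `Ideal.ramificationIdx'_algebra_tower'`).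
presearch: «valuation of the completion restricted to the decomposition field» → Neukirch ANT II (9.6) (decomposition field ↪ K_𝔭, e = f = 1 below),
Serre *Local Fields* II §3; folklore, no new fact. beyond-print theorem: no.

References: [NeukirchANT1999] Ch. I §11, Ch. II §3 (3.8), §8 (8.1)–(8.2), §9 (9.6); [SerreLocalFields1979] Ch. II §3, Ch. XIV §1 Prop. 3;
[NeukirchSchmidtWingberg2008] (7.2.6); [MilneADT2006] I §2.
-/

open scoped Classical WithZero ContRepresentation NumberField Pointwise Valued
open NumberField IsDedekindDomain Field Function WithZero
open _root_.ContinuousCohomology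
open Literature.NumberTheory.GaloisRepresentations
open Literature.NumberTheory.GaloisRepresentations.DiscreteGaloisModule
open Literature.NumberTheory.GaloisRepresentations.LocalWeilDatum Literature.NumberTheory.GaloisRepresentations.IsNonarchimedeanLocalField
open Literature.NumberTheory.GaloisCohomology
open Literature.NumberTheory.EllipticCurves

set_option linter.dupNamespace false
set_option autoImplicit false

namespace Summit.BirchSwinnertonDyer.BirchSwinnertonDyer.Theorems.PrintCf2.NormAtVbar

/-! ## §1. A sandwich: a multiplicative ultrametric `V ≤ 1` on a Dedekind domain with `V(𝔭) ≤ q⁻¹` and `V(π) = q⁻¹` for some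
`π ∈ 𝔭` IS the `𝔭`-adic valuation -/

section Sandwich

/-- **`x ∈ 𝔭^m ⟹ V x ≤ exp(-m)`** for a multiplicative ultrametric `V : R → ℤᵐ⁰` with `V ≤ 1` and `V ≤ exp(-1)` on `𝔭`
(induction on `m`, `𝔭^{m+1} = 𝔭 · 𝔭^m`). [cite: NeukirchANT1999, Ch. I §11, Ch. II §3 (3.8)] -/
theorem le_exp_neg_of_mem_pow {R : Type*} [CommRing R] (𝔭 : Ideal R) (V : R → ℤᵐ⁰) (hmul : ∀ x y, V (x * y) = V x * V y)
    (hadd : ∀ x y, V (x + y) ≤ max (V x) (V y)) (hle : ∀ x, V x ≤ 1) (h𝔭V : ∀ x ∈ 𝔭, V x ≤ exp (-1))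
    (m : ℕ) : ∀ x ∈ 𝔭 ^ m, V x ≤ exp (-(m : ℤ)) := by
  induction m with
  | zero =>
    intro x _
    simpa using hle x
  | succ m ih =>
    intro x hx
    rw [pow_succ'] at hx
    refine Submodule.mul_induction_on hx (fun i hi j hj ↦ ?_) (fun x y hx hy ↦ (hadd x y).trans (max_le hx hy))
    rw [hmul]
    calc V i * V j ≤ exp (-1) * exp (-(m : ℤ)) := mul_le_mul' (h𝔭V i hi) (ih j hj)
      _ = exp (-((m + 1 : ℕ) : ℤ)) := by
        rw [← exp_add]
        congr 1
        push_cast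
        ring

/-- **The sandwich.** On a Dedekind domain `R` with a height-one prime `𝔭`, a map `V : R → ℤᵐ⁰` which is multiplicative,
ultrametric, `≤ 1`, `≤ exp(-1)` on `𝔭`, and takes the value `exp(-1)` at some `π ∈ 𝔭` coincides with the `𝔭`-adic valuation on
`R ∖ {0}`: if `ord_𝔭(a) = k` then `a ∈ 𝔭^k` gives `V a ≤ exp(-k)`, and `𝔭^{k+1} + (a) = 𝔭^k ∋ π^k` (`Ideal.irreducible_pow_sup_of_ge`)
gives `exp(-k) = V(π^k) ≤ max(exp(-(k+1)), V a)`, whence `V a ≥ exp(-k)`. [cite: NeukirchANT1999, Ch. I §11 (11.5), Ch. II §3 (3.8)] -/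
theorem eq_intValuation_of_sandwich {R : Type*} [CommRing R] [IsDedekindDomain R] (v : HeightOneSpectrum R) (V : R → ℤᵐ⁰) (hmul : ∀ x y, V (x * y) = V x * V y)
    (hadd : ∀ x y, V (x + y) ≤ max (V x) (V y)) (hle : ∀ x, V x ≤ 1) (h𝔭V : ∀ x ∈ v.asIdeal, V x ≤ exp (-1))
    (π : R) (hπ : π ∈ v.asIdeal) (hVπ : V π = exp (-1)) (a : R) (ha : a ≠ 0) : V a = v.intValuation a := by
  classical
  obtain ⟨k, hk⟩ : ∃ k : ℕ, v.intValuation a = exp (-(k : ℤ)) := ⟨_, v.intValuation_if_neg ha⟩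
  have hak : a ∈ v.asIdeal ^ k := (v.intValuation_le_pow_iff_mem a k).1 hk.le
  -- `V 1 = 1` and `V (π ^ m) = exp (-m)`
  have hV1 : V 1 = 1 := by
    have h := hmul π 1
    rw [mul_one, hVπ] at h
    exact (mul_eq_left₀ exp_ne_zero).1 h.symm
  have hVpow : ∀ m : ℕ, V (π ^ m) = exp (-(m : ℤ)) := fun m ↦ by
    induction m with
    | zero => simp [hV1]
    | succ m ih =>
      rw [pow_succ, hmul, ih, hVπ, ← exp_add]
      congr 1
      push_cast
      ring
  -- upper bound
  have hup : V a ≤ exp (-(k : ℤ)) := le_exp_neg_of_mem_pow v.asIdeal V hmul hadd hle h𝔭V k a hak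
  -- `𝔭^(k+1) ⊔ (a) = 𝔭^k`
  have hsr : Ideal.span {a} ≠ ⊥ := by simpa [Ideal.span_singleton_eq_bot] using ha
  have hfm : FiniteMultiplicity v.asIdeal (Ideal.span {a}) := FiniteMultiplicity.of_prime_left v.prime hsr
  have hmult : multiplicity v.asIdeal (Ideal.span {a}) = k := by
    have h := v.intValuation_eq_exp_neg_multiplicity ha
    rw [hk, exp_inj, neg_inj] at h
    exact_mod_cast h.symm
  have hsup : v.asIdeal ^ (k + 1) ⊔ Ideal.span {a} = v.asIdeal ^ k := by
    rw [Ideal.irreducible_pow_sup_of_ge hsr v.irreducible (k + 1) ?_, hmult]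
    rw [hfm.emultiplicity_eq_multiplicity, hmult]
    exact_mod_cast Nat.le_succ k
  -- lower bound: `π ^ k = s + r * a` with `s ∈ 𝔭^(k+1)`
  have hπk : π ^ k ∈ v.asIdeal ^ (k + 1) ⊔ Ideal.span {a} := hsup ▸ Ideal.pow_mem_pow hπ k
  obtain ⟨s, hs, t, ht, hst⟩ := Submodule.mem_sup.1 hπk
  obtain ⟨r, rfl⟩ := Ideal.mem_span_singleton'.1 ht
  have hVs : V s ≤ exp (-((k + 1 : ℕ) : ℤ)) := le_exp_neg_of_mem_pow v.asIdeal V hmul hadd hle h𝔭V (k + 1) s hs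
  have hlow : exp (-(k : ℤ)) ≤ max (exp (-((k + 1 : ℕ) : ℤ))) (V a) := by
    calc exp (-(k : ℤ)) = V (s + r * a) := by rw [hst, hVpow]
      _ ≤ max (V s) (V (r * a)) := hadd s (r * a)
      _ ≤ max (exp (-((k + 1 : ℕ) : ℤ))) (V a) := max_le_max hVs (by rw [hmul]; exact mul_le_of_le_one_left' (hle r))
  rw [hk]
  refine le_antisymm hup ?_
  rcases le_max_iff.1 hlow with h | h
  · rw [exp_le_exp] at h
    push_cast at h
    omega
  · exact h

end Sandwich

/-! ## §2. The valuation of `K_v̄` restricted to a subfield `Z ⊆ K̄` fixed by `D_v̄` is the `w₀`-adic valuation, `w₀ = 𝔓₀ ∩ Z` -/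

section Valuation

variable (K : Type) [Field K] [NumberField K]

/-- **`|ẑ|_v̄ = |z|_{w₀}`.** Let `Z ⊆ K̄` be a finite Galois extension of the number field `K` FIXED by the decomposition group
`D_v̄ = res(Γ_{K_v̄})` of the chosen prime `𝔓₀ = adicCompletionPrime K v̄` and containing no inertia above `v̄` in its Galois group
(`I_𝔓 ≤ Gal(K̄/Z)` for all `𝔓 ∣ v̄`, so `e(w₀∣v̄) = 1`, `isUnramifiedIn_of_forall_inertia_le`), and let `w₀` be the place of `Z` below `𝔓₀`.
Every `z ∈ Z` is `D_v̄`-fixed, so `ι(z) ∈ K_v̄ ⊆ \\bar K_v̄` (`mem_range_of_forall_absGaloisRestrict_smul_eq`), say `ι(z) = ẑ`; then the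
`v̄`-adic valuation of `ẑ` equals the `w₀`-adic valuation of `z`. Proof: `x ↦ |x̂|_v̄` is multiplicative, ultrametric, `≤ 1` on `𝓞 Z`
(`spectralNorm_absClosureEmbedding_le_one`), `< 1` exactly on `w₀ = ι⁻¹(𝔪) ∩ 𝓞 Z` (`mem_adicCompletionPrime_iff`), and equals `exp(-1)` at a
`v̄`-uniformizer `π ∈ K` — which is also a `w₀`-uniformizer since `e(w₀∣v̄) = 1` (`intValuation_liesOver`); conclude by the sandwich
`eq_intValuation_of_sandwich` on `𝓞 Z` and pass to fractions. [cite: NeukirchANT1999, Ch. II §8 (8.1)–(8.2), §9 (9.6)]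
[cite: SerreLocalFields1979, Ch. II §3 Thm. 1 Cor. 1] -/
theorem valued_eq_valuation_of_forall_absGaloisRestrict_mem_galFixing (vbar : HeightOneSpectrum (𝓞 K))
    (Z : IntermediateField K (AlgebraicClosure K)) [FiniteDimensional K Z] [IsGalois K Z] [NumberField Z]
    (hDZ : ∀ σ : absoluteGaloisGroup (vbar.adicCompletion K), absGaloisRestrict K (vbar.adicCompletion K) σ ∈ galFixing K Z)
    (hIZ : ∀ 𝔓 ∈ vbar.primesAbove, 𝔓.inertia (absoluteGaloisGroup K) ≤ galFixing K Z)
    (w₀ : HeightOneSpectrum (𝓞 Z))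
    (hw₀ : (adicCompletionPrime K vbar).comap (ringOfIntegersToIntegralClosure (k := K) (Ω := AlgebraicClosure K) Z) = w₀.asIdeal)
    (z : Z) (zv : vbar.adicCompletion K)
    (hzv : algebraMap (vbar.adicCompletion K) (AlgebraicClosure (vbar.adicCompletion K)) zv =
      absClosureEmbedding K (vbar.adicCompletion K) (z : AlgebraicClosure K)) :
    Valued.v zv = w₀.valuation Z z := by
  classical
  haveI : Module.Finite (𝓞 K) (𝓞 Z) := IsIntegralClosure.finite (𝓞 K) K Z (𝓞 Z)
  haveI := w₀.isPrime
  -- `w₀ ∣ v̄`, `e(w₀ ∣ v̄) = 1`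
  have hunder : w₀.asIdeal.under (𝓞 K) = vbar.asIdeal := by
    rw [← KummerU.comap_algebraMap_eq_under_of_comap_eq Z hw₀]
    exact under_adicCompletionPrime K vbar
  haveI : w₀.asIdeal.LiesOver vbar.asIdeal := ⟨hunder.symm⟩
  have he1 : vbar.asIdeal.ramificationIdx' w₀.asIdeal = 1 := by
    rw [Ideal.ramificationIdx'_eq_ramificationIdx vbar.asIdeal w₀.asIdeal vbar.ne_bot]
    exact (isUnramifiedIn_of_forall_inertia_le Z vbar hIZ).ramificationIdx_eq_one inferInstance
  -- the embedding `e : Z → K_v̄` with `algebraMap (e x) = ι x`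
  have hex : ∀ x : Z, ∃ y : vbar.adicCompletion K, algebraMap (vbar.adicCompletion K) (AlgebraicClosure (vbar.adicCompletion K)) y =
      absClosureEmbedding K (vbar.adicCompletion K) (x : AlgebraicClosure K) := fun x ↦
    mem_range_of_forall_absGaloisRestrict_smul_eq K vbar fun τ ↦ (mem_galFixing_iff K).1 (hDZ τ) (x : AlgebraicClosure K) x.2
  choose e he using hex
  have hinj := (algebraMap (vbar.adicCompletion K) (AlgebraicClosure (vbar.adicCompletion K))).injective
  have he_mul : ∀ x y : Z, e (x * y) = e x * e y := fun x y ↦ hinj (by rw [map_mul, he, he, he]; push_cast; rw [map_mul])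
  have he_add : ∀ x y : Z, e (x + y) = e x + e y := fun x y ↦ hinj (by rw [map_add, he, he, he]; push_cast; rw [map_add])
  have he_div : ∀ x y : Z, e (x / y) = e x / e y := fun x y ↦ hinj (by rw [map_div₀, he, he, he]; push_cast; rw [map_div₀])
  have he_K : ∀ k : K, e (algebraMap K Z k) = algebraMap K (vbar.adicCompletion K) k := fun k ↦ hinj (by
    rw [he, ← IsScalarTower.algebraMap_apply K (vbar.adicCompletion K) (AlgebraicClosure (vbar.adicCompletion K)),
      ← (absClosureEmbedding K (vbar.adicCompletion K)).commutes k, IsScalarTower.algebraMap_apply K Z (AlgebraicClosure K)]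
    rfl)
  have hzv' : zv = e z := hinj (hzv.trans (he z).symm)
  -- `V₁ := |e ·|_v̄` on `𝓞 Z`
  have hnorm : ∀ x : Z, ‖e x‖ = spectralNorm (vbar.adicCompletion K) (AlgebraicClosure (vbar.adicCompletion K))
      (absClosureEmbedding K (vbar.adicCompletion K) (x : AlgebraicClosure K)) := fun x ↦ by
    rw [← he, spectralNorm_extends]
  have hle : ∀ x : 𝓞 Z, Valued.v (e (x : Z)) ≤ 1 := fun x ↦ by
    rw [← Valued.toNormedField.norm_le_one_iff, hnorm]
    exact spectralNorm_absClosureEmbedding_le_one K (vbar.adicCompletion K) (norm_algebraMap_ringOfIntegers_le_one K vbar)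
      (ringOfIntegersToIntegralClosure (k := K) (Ω := AlgebraicClosure K) Z x)
  have hlt : ∀ x : 𝓞 Z, x ∈ w₀.asIdeal → Valued.v (e (x : Z)) ≤ exp (-1) := fun x hx ↦ by
    have h1 : Valued.v (e (x : Z)) < 1 := by
      rw [← Valued.toNormedField.norm_lt_one_iff, hnorm]
      rw [← hw₀, Ideal.mem_comap, mem_adicCompletionPrime_iff] at hx
      exact hx
    refine (lt_mul_exp_iff_le exp_ne_zero).1 ?_
    rwa [← exp_add, neg_add_cancel, exp_zero]
  -- a `v̄`-uniformizer `π₀ ∈ 𝓞 K` is a `w₀`-uniformizer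
  obtain ⟨π₀, hπ₀⟩ := vbar.intValuation_exists_uniformizer
  have hπ₀mem : π₀ ∈ vbar.asIdeal := by
    rw [← HeightOneSpectrum.intValuation_lt_one_iff_mem, hπ₀]
    exact exp_lt_exp.2 (by norm_num) |>.trans_eq exp_zero
  have hπmem : algebraMap (𝓞 K) (𝓞 Z) π₀ ∈ w₀.asIdeal := by
    rw [← hunder] at hπ₀mem
    exact Ideal.mem_comap.1 hπ₀mem
  have hπcoe : ((algebraMap (𝓞 K) (𝓞 Z) π₀ : 𝓞 Z) : Z) = algebraMap K Z (π₀ : K) := by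
    rw [show ((algebraMap (𝓞 K) (𝓞 Z) π₀ : 𝓞 Z) : Z) = algebraMap (𝓞 Z) Z (algebraMap (𝓞 K) (𝓞 Z) π₀) from rfl,
      ← IsScalarTower.algebraMap_apply, IsScalarTower.algebraMap_apply (𝓞 K) K Z]
  have hVπ : Valued.v (e ((algebraMap (𝓞 K) (𝓞 Z) π₀ : 𝓞 Z) : Z)) = exp (-1) := by
    rw [hπcoe, he_K, ← hπ₀, ← HeightOneSpectrum.valuation_of_algebraMap (K := K)]
    exact HeightOneSpectrum.valuedAdicCompletion_eq_valuation' vbar (π₀ : K)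
  -- the sandwich on `𝓞 Z`
  have hint : ∀ a : 𝓞 Z, Valued.v (e (a : Z)) = w₀.intValuation a := fun a ↦ by
    rcases eq_or_ne a 0 with rfl | ha
    · have : e ((0 : 𝓞 Z) : Z) = 0 := hinj (by rw [he, map_zero]; push_cast; rw [map_zero])
      rw [this, map_zero, map_zero]
    exact eq_intValuation_of_sandwich w₀ (fun a : 𝓞 Z ↦ Valued.v (e (a : Z))) (fun x y ↦ by push_cast; rw [he_mul, map_mul])
      (fun x y ↦ by push_cast; rw [he_add]; exact Valuation.map_add _ _ _) hle hlt _ hπmem hVπ a ha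
  -- pass to fractions
  obtain ⟨a, b, hb, rfl⟩ := IsFractionRing.div_surjective (A := 𝓞 Z) z
  rw [hzv', he_div, map_div₀, map_div₀, HeightOneSpectrum.valuation_of_algebraMap, HeightOneSpectrum.valuation_of_algebraMap,
    ← hint a, ← hint b]

end Valuation

/-! ## §3. Assembly with FILE 5: the twisted-split `v̄` reading lands in the place `w₀` of `Z` -/

section Assembly

variable (K : Type) [Field K] [NumberField K] {n : ℕ} [NeZero n]

/-- **B5-T-loc assembled: `loc_v̄[φ] ⟂ H¹_ur` + Kummer reading on `Gal(K̄/Z) ⊇ D_v̄` ⟹ `n ∣ ord_{w₀}(z)`.** Data: `ρ` on `ℤ/n` trivial on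
`res(Γ_{K_v̄})` (the split case `ε|_{D_v̄} = 1`); a `1`-cocycle `φ` of `Γ_K` in `(ℤ/n)^D = ρ.tateDual n` whose class at `v̄` lies in the
dual-of-unramified local condition (canonical pairing); a finite Galois `Z/K` inside `K̄` with `D_v̄ ≤ Gal(K̄/Z)` and all inertia above `v̄`
inside `Gal(K̄/Z)`; the place `w₀` of `Z` below `𝔓₀`; `z ∈ Z` with an `n`-th root `ζ ∈ K̄` such that `φ(g)(1) = g ζ / ζ` (through
`muVal`) for `g ∈ Gal(K̄/Z)`. Conclusion: `(n : ℤ) ∣ log |z|_{w₀}`. Proof: `ι(z) = ẑ ∈ K_v̄` (`mem_range_of_forall_absGaloisRestrict_smul_eq`),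
FILE 5 `dvd_log_valued_of_mem_dualLocalCondition_unramified_of_locallyTrivial` gives `n ∣ log |ẑ|_v̄`, and §2 gives `|ẑ|_v̄ = |z|_{w₀}`.
This is the LOCAL HALF of the twisted `v̄` reading (B5-T): -w4 g14's ρ_ε-probe supplies `φ`, `Z = K_ε`, `z = N_{F′/K_ε}(b′)`.
[cite: SerreLocalFields1979, Ch. XIV §1 Prop. 3] [cite: NeukirchSchmidtWingberg2008, (7.2.6)] [cite: NeukirchANT1999, Ch. II §9 (9.6)] -/
theorem dvd_log_valuation_of_mem_dualLocalCondition_unramified_of_decompFixed (ρ : DiscreteGaloisModule K (ZMod n))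
    (vbar : HeightOneSpectrum (𝓞 K))
    (hloc : ∀ (σ : absoluteGaloisGroup (vbar.adicCompletion K)) (m : ZMod n), ρ (absGaloisRestrict K (vbar.adicCompletion K) σ) m = m)
    (φY : contOneCocycles ((ρ.tateDual n).toTopRep))
    (hY : galoisCohomology.localization (ρ.tateDual n) (Sum.inr vbar) 1 (oneCocycleClass _ φY) ∈
      (LocalInvariants.canonical K n).dualLocalCondition ρ (Sum.inr vbar) (unramifiedSubgroup (GaloisRep.toLocal vbar ρ) 1))
    (Z : IntermediateField K (AlgebraicClosure K)) [FiniteDimensional K Z] [IsGalois K Z] [NumberField Z]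
    (hDZ : ∀ σ : absoluteGaloisGroup (vbar.adicCompletion K), absGaloisRestrict K (vbar.adicCompletion K) σ ∈ galFixing K Z)
    (hIZ : ∀ 𝔓 ∈ vbar.primesAbove, 𝔓.inertia (absoluteGaloisGroup K) ≤ galFixing K Z)
    (w₀ : HeightOneSpectrum (𝓞 Z))
    (hw₀ : (adicCompletionPrime K vbar).comap (ringOfIntegersToIntegralClosure (k := K) (Ω := AlgebraicClosure K) Z) = w₀.asIdeal)
    (z : Z) (ζ : (AlgebraicClosure K)ˣ) (hζ : ((ζ ^ n : (AlgebraicClosure K)ˣ) : AlgebraicClosure K) = (z : AlgebraicClosure K))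
    (hread : ∀ g ∈ galFixing K Z, muVal K n ((φY.1 g) 1) = g • ζ / ζ) :
    (n : ℤ) ∣ WithZero.log (w₀.valuation Z z) := by
  rcases eq_or_ne z 0 with rfl | hz0
  · simp
  obtain ⟨zv, hzv⟩ := mem_range_of_forall_absGaloisRestrict_smul_eq K vbar (x := (z : AlgebraicClosure K))
    fun τ ↦ (mem_galFixing_iff K).1 (hDZ τ) _ z.2
  have hzv0 : zv ≠ 0 := by
    intro h
    apply hz0
    have h1 : absClosureEmbedding K (vbar.adicCompletion K) (z : AlgebraicClosure K) = 0 := by rw [← hzv, h, map_zero]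
    have h2 : (z : AlgebraicClosure K) = 0 := by simpa using h1
    exact_mod_cast h2
  rw [← valued_eq_valuation_of_forall_absGaloisRestrict_mem_galFixing K vbar Z hDZ hIZ w₀ hw₀ z zv hzv]
  exact dvd_log_valued_of_mem_dualLocalCondition_unramified_of_locallyTrivial K ρ vbar hloc φY hY ζ (fun σ ↦ hread _ (hDZ σ)) zv hzv0
    (by rw [hzv, hζ])

end Assembly

/-! ## §4. Reading at a LARGER field `Z′ ⊇ Z` (the consumer's `F′ ⊇ K_ε`): `n · e(w′∣v̄) ∣ ord_{w′}(z′)`, tower-free statement -/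

section Larger

variable (K : Type) [Field K] [NumberField K] {n : ℕ} [NeZero n]

/-- **B5-T-loc read at any finite `Z′ ⊇ Z` (for -w4 g14's assembler, which reads at `Z′ = F′` directly).** Same data as
`dvd_log_valuation_of_mem_dualLocalCondition_unramified_of_decompFixed` for the `D_v̄`-fixed Galois field `Z`, plus a finite `Z′ ⊇ Z` inside `K̄`,
the place `w′` of `Z′` below `𝔓₀`, and `z′ ∈ Z′` whose underlying element of `K̄` lies in `Z`; then
`n · e(w′∣v̄) ∣ log (w′.valuation Z′ z′)`, `e(w′∣v̄) = vbar.asIdeal.ramificationIdx' w′.asIdeal`. Proof: the place `w` of `Z` below `𝔓₀` has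
`e(w∣v̄) = 1`, so `e(w′∣v̄) = e(w′∣w)` (`Ideal.ramificationIdx'_algebra_tower'` in the tower `𝓞 K → 𝓞 Z → 𝓞 Z′` built from
`IntermediateField.inclusion`, local to this proof), `log |z′|_{w′} = e(w′∣w) · log |z|_w` (`valuation_liesOver`), and §3 gives `n ∣ log |z|_w`.
The STATEMENT mentions no `Z`-`Z′` algebra structure. [cite: NeukirchANT1999, Ch. I §8 (8.2), Ch. II §9 (9.6)] [cite: SerreLocalFields1979, Ch. I §4 Prop. 10] -/
theorem mul_ramificationIdx_dvd_log_valuation_of_coe_mem (ρ : DiscreteGaloisModule K (ZMod n)) (vbar : HeightOneSpectrum (𝓞 K))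
    (hloc : ∀ (σ : absoluteGaloisGroup (vbar.adicCompletion K)) (m : ZMod n), ρ (absGaloisRestrict K (vbar.adicCompletion K) σ) m = m)
    (φY : contOneCocycles ((ρ.tateDual n).toTopRep))
    (hY : galoisCohomology.localization (ρ.tateDual n) (Sum.inr vbar) 1 (oneCocycleClass _ φY) ∈
      (LocalInvariants.canonical K n).dualLocalCondition ρ (Sum.inr vbar) (unramifiedSubgroup (GaloisRep.toLocal vbar ρ) 1))
    (Z : IntermediateField K (AlgebraicClosure K)) [FiniteDimensional K Z] [IsGalois K Z] [NumberField Z]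
    (hDZ : ∀ σ : absoluteGaloisGroup (vbar.adicCompletion K), absGaloisRestrict K (vbar.adicCompletion K) σ ∈ galFixing K Z)
    (hIZ : ∀ 𝔓 ∈ vbar.primesAbove, 𝔓.inertia (absoluteGaloisGroup K) ≤ galFixing K Z)
    (Z' : IntermediateField K (AlgebraicClosure K)) [FiniteDimensional K Z'] [NumberField Z'] (hle : Z ≤ Z')
    (w' : HeightOneSpectrum (𝓞 Z'))
    (hw' : (adicCompletionPrime K vbar).comap (ringOfIntegersToIntegralClosure (k := K) (Ω := AlgebraicClosure K) Z') = w'.asIdeal)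
    (z' : Z') (hz' : (z' : AlgebraicClosure K) ∈ Z)
    (ζ : (AlgebraicClosure K)ˣ) (hζ : ((ζ ^ n : (AlgebraicClosure K)ˣ) : AlgebraicClosure K) = (z' : AlgebraicClosure K))
    (hread : ∀ g ∈ galFixing K Z, muVal K n ((φY.1 g) 1) = g • ζ / ζ) :
    ((n : ℤ) * (vbar.asIdeal.ramificationIdx' w'.asIdeal : ℕ)) ∣ WithZero.log (w'.valuation Z' z') := by
  classical
  -- the place `w` of `Z` below `𝔓₀`
  haveI : (Ideal.comap (ringOfIntegersToIntegralClosure (k := K) (Ω := AlgebraicClosure K) Z) (adicCompletionPrime K vbar)).IsPrime :=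
    Ideal.IsPrime.comap _
  have hunderZ : (Ideal.comap (ringOfIntegersToIntegralClosure (k := K) (Ω := AlgebraicClosure K) Z) (adicCompletionPrime K vbar)).under
      (𝓞 K) = vbar.asIdeal := by
    ext x
    simp only [Ideal.under_def, Ideal.mem_comap]
    rw [← under_adicCompletionPrime K vbar, Ideal.under_def, Ideal.mem_comap]
    have hx := RingHom.congr_fun (ringOfIntegersToIntegralClosure_comp_algebraMap (k := K) (Ω := AlgebraicClosure K) Z) x
    rw [RingHom.comp_apply] at hx
    exact Iff.of_eq (congrArg (· ∈ adicCompletionPrime K vbar) hx)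
  haveI hLZ : (Ideal.comap (ringOfIntegersToIntegralClosure (k := K) (Ω := AlgebraicClosure K) Z)
      (adicCompletionPrime K vbar)).LiesOver vbar.asIdeal := ⟨hunderZ.symm⟩
  have h𝔭ne : Ideal.comap (ringOfIntegersToIntegralClosure (k := K) (Ω := AlgebraicClosure K) Z) (adicCompletionPrime K vbar) ≠ ⊥ :=
    Ideal.ne_bot_of_liesOver_of_ne_bot vbar.ne_bot _
  let w : HeightOneSpectrum (𝓞 Z) := ⟨_, inferInstance, h𝔭ne⟩
  haveI := w'.isPrime
  haveI : Module.Finite (𝓞 K) (𝓞 Z) := IsIntegralClosure.finite (𝓞 K) K Z (𝓞 Z)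
  have he1 : vbar.asIdeal.ramificationIdx' w.asIdeal = 1 := by
    rw [Ideal.ramificationIdx'_eq_ramificationIdx vbar.asIdeal w.asIdeal vbar.ne_bot]
    exact (isUnramifiedIn_of_forall_inertia_le Z vbar hIZ).ramificationIdx_eq_one inferInstance
  -- §3 at `Z`
  set z : Z := ⟨(z' : AlgebraicClosure K), hz'⟩ with hzdef
  have h3 : (n : ℤ) ∣ WithZero.log (w.valuation Z z) :=
    dvd_log_valuation_of_mem_dualLocalCondition_unramified_of_decompFixed K ρ vbar hloc φY hY Z hDZ hIZ w rfl z ζ (by rw [hζ]) hread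
  -- the tower `𝓞 K → 𝓞 Z → 𝓞 Z′`, local to this proof
  letI : Algebra Z Z' := (IntermediateField.inclusion hle).toAlgebra
  haveI : IsScalarTower K Z Z' := IsScalarTower.of_algebraMap_eq fun k ↦ ((IntermediateField.inclusion hle).commutes k).symm
  haveI : IsScalarTower (𝓞 K) (𝓞 Z) (𝓞 Z') := IsScalarTower.of_algebraMap_eq fun x ↦ by
    apply Subtype.ext
    change (algebraMap K Z' (x : K) : Z') = algebraMap Z Z' (algebraMap K Z (x : K))
    rw [IsScalarTower.algebraMap_apply K Z Z']
  haveI hLw : w'.asIdeal.LiesOver w.asIdeal := ⟨by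
    ext x
    rw [Ideal.under_def, ← hw']
    change x ∈ Ideal.comap (ringOfIntegersToIntegralClosure (k := K) (Ω := AlgebraicClosure K) Z) (adicCompletionPrime K vbar) ↔ _
    simp only [Ideal.mem_comap]
    rfl⟩
  have htower := Ideal.ramificationIdx'_algebra_tower' vbar.asIdeal w.asIdeal w'.asIdeal
  rw [he1, one_mul] at htower
  have hval := HeightOneSpectrum.valuation_liesOver Z' w w' (z : Z)
  have hzz : algebraMap Z Z' z = z' := Subtype.ext rfl
  rw [hzz] at hval
  rw [← hval, WithZero.log_pow, nsmul_eq_mul, htower, mul_comm (n : ℤ)]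
  exact mul_dvd_mul_left _ h3

end Larger

end Summit.BirchSwinnertonDyer.BirchSwinnertonDyer.Theorems.PrintCf2.NormAtVbar
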